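import Summits.CriticalPhenomena.PercolationContinuityZ3.Theorems.Transplant.FKDoubleFanOSDEndpoints
import HarnessLib

/-!
# Double fans `K₂ ∨ P_{m+1}`: the `a`-SIDED CONE — the far cross-apex pair for EVERY middle word from ONE closure statement with affine legs

Helper file (`--supports stmt-CriticalPhenomena-4575`), FK sub-lane `prim-bschramm-fk-3` (gen 37); builds on p205010 (kernel theorem, internal
audit signed; external expert review pending).  No named facts, no sorries; standard axioms.  Memo `bschramm/prim-bschramm-fk-3/FAR-CROSS-XII.md` §3.

`…OneSidedDominance` reduces the far theorem for all middles to TWO closure statements, `HypA` (an `a`-spoke after a `b`-gadget) and `HypB`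
(a `b`-spoke after an `a`-gadget), about the bi-dual of the cone generated by BOTH kinds of one-sided images.  The `b`-gadget of `HypA` acts on an
`a`-pinned frame, so its fan leg is QUADRATIC along the fibre — the obstruction to a finite reduction.  Here the `b`-images are dropped altogether:
**`osConeA q`** is the bi-dual of the `a`-images `imgA q F w` (`F, w ∈ InKE q`) alone (**`OSDualA`**).  It contains the inputs
(**`input_mem_osConeA`**), pairs `≥ 0` with every target by LEMMA′ only (**`target_osDualA`** — no mirror identity needed), is stable under rim steps
and `a`-spokes by the fan algebra, and is stable under `b`-spokes as soon as
  **(CL)** `HypBa q`: `opBC y (imgA q F w) ∈ osConeA q` for all `F, w ∈ InKE q`, `y ∈ [0,1]`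
(**`isLetterCone_osConeA`**).  Hence (**`rayleigh_crossFar_of_hypBa`**, **`negCorr_spokes_cross_far_of_hypBa`**): `HypBa q` ALONE implies, for
`0 < q ≤ 1`, negative correlation of every cross-apex pair `(a c_j, b c_k)`, `j < k ≤ m`, of every weighted double fan — all middles, all distances.
In (CL) the `a`-gadget `F` sits on a frame pinned at ITS OWN apex, so BOTH legs are affine along their fibres (`imgA_ufibre` of `…OSDEndpoints`,
`wedgeH_fanCombo_fibre` of `…MultifanForm`): **`hypBa_of_endpoints`** reduces the input leg to the endpoint inputs exactly as for `HypA/HypB`, and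
`HypBa q → HypB q`-type monotonicity is **`osConeA_subset_osCone`** (the `a`-sided cone is the smaller bi-dual).  Numerically (memo §3: exact rational
decompositions of `∧²(B_y A_x E_r)β_w` and of generic `b`-images into `a`-images; cutting-plane tests) (CL) is consistent in every test.
[folklore]
-/

noncomputable section

namespace Summit.CriticalPhenomena.PercolationContinuityZ3.Theorems

namespace FK

namespace ThreeApex

/-! ### The `a`-sided dual and bi-dual -/

/-- The dual of the `a`-images alone: bivectors pairing non-negatively with every `imgA q F w`, `F, w ∈ InKE q`. [folklore] -/
def OSDualA (q : ℝ) (γ : Biv) : Prop := ∀ F w : V5, InKE q F → InKE q w → 0 ≤ pairH q (imgA q F w) γ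

/-- **The `a`-sided cone**: the closed convex cone bi-dual to the `a`-images. [folklore] -/
def osConeA (q : ℝ) : Set Biv := {β | ∀ γ : Biv, OSDualA q γ → 0 ≤ pairH q β γ}

/-- `a`-images lie in the `a`-sided cone. [folklore] -/
theorem imgA_mem_osConeA {q : ℝ} {F w : V5} (hF : InKE q F) (hw : InKE q w) : imgA q F w ∈ osConeA q :=
  fun _ hγ => hγ F w hF hw

/-- **Inputs lie in the `a`-sided cone.** [folklore] -/
theorem input_mem_osConeA {q : ℝ} {u : V5} (hu : InKE q u) : wedgeH (conv (edgeAC 0) u) (conv (edgeAC 1) u) ∈ osConeA q := by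
  rw [← imgA_fanInit]; exact imgA_mem_osConeA (fanInit_inKE q) hu

/-- The full one-sided dual is contained in the `a`-sided dual. [folklore] -/
theorem OSDual.osDualA {q : ℝ} {γ : Biv} (h : OSDual q γ) : OSDualA q γ := h.1

/-- **The `a`-sided cone is the smaller bi-dual**: `osConeA q ⊆ osCone q`. [folklore] -/
theorem osConeA_subset_osCone (q : ℝ) : osConeA q ⊆ osCone q :=
  fun _ hβ γ hγ => hβ γ hγ.osDualA

/-- **(CL)**: every `b`-spoke applied to every `a`-gadget image of an input stays in the `a`-sided cone. [folklore] -/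
def HypBa (q : ℝ) : Prop := ∀ (F w : V5) (y : ℝ), InKE q F → InKE q w → 0 ≤ y → y ≤ 1 → opBC y (imgA q F w) ∈ osConeA q

namespace OSDualA

variable {q : ℝ} {γ : Biv}

/-- The `a`-sided dual is stable under rim steps. [folklore] -/
theorem rim (hγ : OSDualA q γ) {r : ℝ} (hr0 : 0 ≤ r) (hr1 : r ≤ 1) : OSDualA q (opE q r γ) := fun F w hF hw => by
  rw [← pairH_opE, opE_imgA]; exact hγ _ _ (InKE.rim hr0 hr1 hF) hw

/-- The `a`-sided dual is stable under `a`-spokes. [folklore] -/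
theorem ac (hγ : OSDualA q γ) {x : ℝ} (hx0 : 0 ≤ x) (hx1 : x ≤ 1) : OSDualA q (opAC x γ) := fun F w hF hw => by
  rw [← pairH_opAC, opAC_imgA]; exact hγ _ _ (InKE.step (IsLetter.bc hx0 hx1) hF) hw

/-- The `a`-sided dual is stable under `b`-spokes, given (CL). [folklore] -/
theorem bc (hγ : OSDualA q γ) (hB : HypBa q) {y : ℝ} (hy0 : 0 ≤ y) (hy1 : y ≤ 1) : OSDualA q (opBC y γ) := fun F w hF hw => by
  rw [← pairH_opBC]; exact hB F w y hF hw hy0 hy1 γ hγ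

end OSDualA

/-- **Under (CL) the `a`-sided cone is a letter cone.** [folklore] -/
theorem isLetterCone_osConeA {q : ℝ} (hB : HypBa q) : IsLetterCone q (osConeA q) where
  zero_mem := fun γ _ => le_of_eq (pairH_zero_left q γ).symm
  add_mem := fun β γ hβ hγ δ hδ => by rw [pairH_add_left]; exact add_nonneg (hβ δ hδ) (hγ δ hδ)
  smul_mem := fun a β ha hβ δ hδ => by rw [pairH_smul_left]; exact mul_nonneg ha (hβ δ hδ)
  rim := fun r β hr0 hr1 hβ γ hγ => by rw [pairH_opE]; exact hβ _ (hγ.rim hr0 hr1)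
  ac := fun x β hx0 hx1 hβ γ hγ => by rw [pairH_opAC]; exact hβ _ (hγ.ac hx0 hx1)
  bc := fun y β hy0 hy1 hβ γ hγ => by rw [pairH_opBC]; exact hβ _ (hγ.bc hB hy0 hy1)

/-- **Every target lies in the `a`-sided dual** (`0 < q ≤ 1`, `s ∈ InKE q`): this is LEMMA′ (`fanPhi_nonneg`) and nothing else. [folklore] -/
theorem target_osDualA {q : ℝ} (hq0 : 0 < q) (hq1 : q ≤ 1) {s : V5} (hs : InKE q s) :
    OSDualA q (wedgeH (conv s (edgeBC 0)) (conv s (edgeBC 1))) :=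
  (target_osDual hq0 hq1 hs).osDualA

/-- The `a`-sided cone pairs non-negatively with every target. [folklore] -/
theorem pairH_osConeA_target {q : ℝ} (hq0 : 0 < q) (hq1 : q ≤ 1) {s : V5} (hs : InKE q s) :
    ∀ β, β ∈ osConeA q → 0 ≤ pairH q β (wedgeH (conv s (edgeBC 0)) (conv s (edgeBC 1))) :=
  fun _ hβ => hβ _ (target_osDualA hq0 hq1 hs)

/-! ### The reduction: (CL) ⟹ the far cross-apex pair for every middle -/

/-- **(CL) ⟹ THE ALGEBRA-LEVEL FAR THEOREM.**  Under `HypBa q`, `0 < q ≤ 1`, the Rayleigh difference of the `crossFarZ` valuations is `≥ 0` for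
every block list with weights in `[0,1]`, every last rim weight and all rests `u, s ∈ InKE q`. [folklore] -/
theorem rayleigh_crossFar_of_hypBa {q : ℝ} (hq0 : 0 < q) (hq1 : q ≤ 1) (hB : HypBa q) :
    ∀ (mids : List (ℝ × ℝ × ℝ)), UnitBlocks mids → ∀ rd : ℝ, 0 ≤ rd → rd ≤ 1 → ∀ u s : V5, InKE q u → InKE q s →
      0 ≤ crossFarZ q mids rd u s 1 0 * crossFarZ q mids rd u s 0 1 - crossFarZ q mids rd u s 1 1 * crossFarZ q mids rd u s 0 0 := by
  intro mids hm rd hrd0 hrd1 u s hu hs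
  have key := rayleigh_crossFar_of_isLetterCone (isLetterCone_osConeA hB) hm hrd0 hrd1 (input_mem_osConeA hu)
    (pairH_osConeA_target hq0 hq1 hs)
  simp only [crossFarZ]
  linarith [key]

/-- **(CL) from the endpoint inputs** (`0 < q < 1`): it suffices to check `opBC y (imgA q F v) ∈ osConeA q` on the degenerate frames, the floor
points and the roof points of the apex-`b` frame (the input leg is affine along its fibre). [folklore] -/
theorem hypBa_of_endpoints {q : ℝ} (hq0 : 0 < q) (hq1 : q < 1)
    (hdeg : ∀ (F : V5) (y' y u0 : ℝ), InKE q F → 0 ≤ y' → y' ≤ 1 → 0 ≤ u0 → u0 ≤ y →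
      opBC y' (imgA q F (vecB q (q * y) y 0 0 u0)) ∈ osConeA q)
    (hfloor : ∀ (F : V5) (y' W y X Z : ℝ), InKE q F → 0 ≤ y' → y' ≤ 1 → 0 ≤ X → 0 ≤ Z → 0 ≤ y → q * y < W → 0 ≤ W - q * y - X - Z →
      opBC y' (imgA q F (vecB q W y X Z 0)) ∈ osConeA q)
    (hroof : ∀ (F : V5) (y' κ l t w : ℝ), InKE q F → 0 ≤ y' → y' ≤ 1 → 0 ≤ κ → 0 < l → 0 ≤ t → 0 ≤ w → w ≤ 1 →
      opBC y' (imgA q F (roofV q κ l t w)) ∈ osConeA q) :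
    HypBa q := by
  intro F w y' hF hw hy0 hy1 γ hγ
  have hwN : w.Nonneg := (hw.valid hq0.le hq1.le).nonneg
  have hwU : UCond q (swapAB w) := hw.uCondB hq0 hq1.le
  exact nonneg_of_rays_gen hq0 hq1 (Φ := fun v => pairH q (opBC y' (imgA q F v)) γ)
    (fun W y X Z a b c => pairH_opBC_imgA_affine q y' F γ W y X Z a b c)
    (fun y u0 hu0 hu0y => hdeg F y' y u0 hF hy0 hy1 hu0 hu0y γ hγ)
    (fun W y X Z hX hZ hy hW h1 => hfloor F y' W y X Z hF hy0 hy1 hX hZ hy hW h1 γ hγ)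
    (fun κ l t w' hκ hl ht hw0 hw1 => hroof F y' κ l t w' hF hy0 hy1 hκ hl ht hw0 hw1 γ hγ) hwN hwU

/-- `HypBa 1` holds trivially (the pairing vanishes at `q = 1`). [folklore] -/
theorem hypBa_one : HypBa 1 := fun _ _ _ _ _ _ _ γ _ => (pairH_one _ γ).symm.le

open MeasureTheory Literature.Probability.LatticeModels Literature.Probability.Percolation
open scoped Classical

variable {V : Type*} [Fintype V]

section Setting

variable {a b : V} {c : ℕ → V} {m : ℕ}
variable (hab : a ≠ b) (hinj : ∀ j k, j ≤ m → k ≤ m → c j = c k → j = k) (hca : ∀ j, j ≤ m → c j ≠ a) (hcb : ∀ j, j ≤ m → c j ≠ b)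
include hab hinj hca hcb

/-- **(CL) ⟹ NEGATIVE CORRELATION OF EVERY CROSS-APEX PAIR AT EVERY DISTANCE.**  If the single closure statement `HypBa q` holds at
`q ∈ (0,1]`, then for every weighted double fan (`card V = m + 3`, weights supported on the double-fan pairs) and all `j < k ≤ m`:
`φ(J_{a c_j} ∩ J_{b c_k}) ≤ φ(J_{a c_j})·φ(J_{b c_k})` — no restriction on the middle. [folklore] -/
theorem negCorr_spokes_cross_far_of_hypBa (hcard : Fintype.card V = m + 3) {q : ℝ} (hq0 : 0 < q) (hq1 : q ≤ 1)
    (w : Sym2 V → unitInterval) (hsupp : ∀ e, e ∉ dfPairs a b c m → w e = 0) (hB : HypBa q) {j k : ℕ} (hjk : j < k) (hk : k ≤ m) :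
    (rcMeasureW w q ∅).real ({ω : BondConfig V | s(a, c j) ∈ ω} ∩ {ω | s(b, c k) ∈ ω}) ≤
      (rcMeasureW w q ∅).real {ω : BondConfig V | s(a, c j) ∈ ω} * (rcMeasureW w q ∅).real {ω : BondConfig V | s(b, c k) ∈ ω} :=
  negCorr_spokes_cross_far_of_inKE hab hinj hca hcb hcard hq0 w hsupp (rayleigh_crossFar_of_hypBa hq0 hq1 hB) hjk hk

end Setting

end ThreeApex

end FK

end Summit.CriticalPhenomena.PercolationContinuityZ3.Theorems
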